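import Literature.NumberTheory.CubicFields.PureCubicLexMinFound
import Literature.NumberTheory.CubicFields.PureCubicLexMinRange
import HarnessLib

/-!
# Correctness of the program `lexE`: the least cylinder element of a lattice of a pure cubic field

Topic `NumberTheory/CubicFields`, sub-namespace `PureCubicLexMin.Correctness`. The specification of
the program `lexE` of `PureCubicLexMinProgram.lean` (**`lexE_correct`**): for `ab` squarefree,
`ab ≠ 1`, a cubic field `K ∋ θ` with `θ³ = ab²`, a real embedding `σ₁`, a non-real embedding `σ₂`,
and a canonical lattice code `c` (`PureCubicCodes.Canon`) whose member set (`PureCubicCodes.Mem`) is a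
nonzero fractional ideal `I`, the element code `lexE ((a, b), c)` has denominator `≥ 1`, names a
member of `c` lying in the open unit cylinder `{σ₁ > 0, ‖σ₂‖ < 1}`, and its real conjugate is least
among the members of `c` in that cylinder (the reducing element of the Buchmann–Williams giant step).

Proof: the cylinder minimum `γ` exists (`VoronoiReduction.exists_cylinder_min`); its true scale
`s = ⌊log₂ σ₁ γ⌋` is scanned (`natAbs_log_le`, `PureCubicLexMinRange.lean`) and at that scale its
coordinate row is a candidate (`coords_mem_perScale`, `PureCubicLexMinFound.lean`); the exact filters
keep exactly the cylinder members (`inCyl_eq_true_iff`, `sigma1_lin_div_pos_iff`,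
`norm_sigma2_lin_div_lt_one_iff`) and the selection keeps those of least real conjugate
(`isLt_eq_true_iff`, `sigma1_lin_div_lt_iff`), so the selected list is nonempty and its head is a
cylinder member of least real conjugate. The two rank-`3` lattice inputs are hypotheses `hC1`, `hC2`
as in `ShortVectorBoxFinThree.lean`.

## References

* J. Buchmann, H. C. Williams, *On the infrastructure of the principal ideal class of an algebraic
  number field of unit rank one*, Math. Comp. 50 (1988), §3. [folklore]
* H. Cohen, *A Course in Computational Algebraic Number Theory*, GTM 138 (1993), §6.5. [Cohen1993]
-/

noncomputable section

namespace Literature.NumberTheory.CubicFields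

namespace PureCubicLexMin

namespace Correctness

open Literature.Computability.Complexity Literature.Computability.Complexity.CodeFP
  Literature.Algebra.EuclideanLattices PureCubicCodes
open scoped NumberField ComplexConjugate nonZeroDivisors

/-- `|s| ≤ S` as a two-sided range. [folklore] -/
theorem neg_le_and_le_of_natAbs_le {S : ℕ} {s : ℤ} (h : s.natAbs ≤ S) : -(S : ℤ) ≤ s ∧ s ≤ (S : ℤ) := by
  omega

/-- **Correctness of `lexE`.** For a canonical lattice code `c` whose member set is a nonzero
fractional ideal `I` of the pure cubic field `K = ℚ(θ)`, `θ³ = ab²`: `lexE ((a, b), c)` is an element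
code of denominator `≥ 1` whose value is a member of `c` in the open unit cylinder
`{σ₁ > 0, ‖σ₂‖ < 1}` of least real conjugate there. [cite: Cohen1993, §6.5] -/
theorem lexE_correct
    (hC1 : ∀ (b : Fin 3 → EuclideanSpace ℝ (Fin 3)), LinearIndependent ℝ b → IsLLLReduced (3 / 4) b →
      ∀ (m ρ : ℝ), 0 < m → (∀ c : Fin 3 → ℤ, c ≠ 0 → m ≤ ‖∑ i, (c i : ℝ) • b i‖) →
        ∀ c : Fin 3 → ℤ, ‖∑ i, (c i : ℝ) • b i‖ ≤ ρ → ∀ i, |(c i : ℝ)| ≤ 4 * ρ / m + 2)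
    (hC2 : ∀ (B B' : Matrix (Fin 3) (Fin 3) ℝ) (δ μ : ℝ), 0 ≤ δ → 0 < μ →
      (∀ i j, |B i j - B' i j| ≤ δ) → (∀ v : Fin 3 → ℝ, μ * ‖v‖ ≤ ‖Matrix.vecMul v B‖) → 3 * δ < μ →
      ∀ c : Fin 3 → ℤ,
        ‖Matrix.vecMul (fun i => (c i : ℝ)) B'‖ ≤ ‖Matrix.vecMul (fun i => (c i : ℝ)) B‖ * (1 + 3 * δ / μ) ∧
        ‖Matrix.vecMul (fun i => (c i : ℝ)) B‖ * (1 - 3 * δ / μ) ≤ ‖Matrix.vecMul (fun i => (c i : ℝ)) B'‖)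
    {K : Type*} [Field K] [NumberField K] {a b : ℕ} {θ : K} (σ₁ : K →+* ℝ) (σ₂ : K →+* ℂ)
    (hdeg : Module.finrank ℚ K = 3) (hab : Squarefree (a * b)) (hab1 : a * b ≠ 1)
    (hθ : θ ^ 3 = ((a * b ^ 2 : ℕ) : K)) (hσ₂ : ∃ z : K, conj (σ₂ z) ≠ σ₂ z)
    {c : ℕ × List ℤ} (hc : Canon c) {I : FractionalIdeal (𝓞 K)⁰ K} (hI0 : I ≠ 0)
    (hI : ∀ φ : K, Mem θ b c φ ↔ φ ∈ I) :
    1 ≤ (lexE ((a, b), c)).2.2.2 ∧ Mem θ b c (val θ b (lexE ((a, b), c))) ∧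
      0 < σ₁ (val θ b (lexE ((a, b), c))) ∧ ‖σ₂ (val θ b (lexE ((a, b), c)))‖ < 1 ∧
      ∀ φ : K, Mem θ b c φ → 0 < σ₁ φ → ‖σ₂ φ‖ < 1 → σ₁ (val θ b (lexE ((a, b), c))) ≤ σ₁ φ := by
  rcases c with ⟨den, hs⟩
  obtain ⟨h11, h12, h13, h22, h23, h33, hc2, p11, p22, p33, -, -, -, -, -, -, hden, -⟩ := hc
  change hs = [h11, h12, h13, h22, h23, h33] at hc2
  change 1 ≤ den at hden
  subst hc2
  have hden0 : den ≠ 0 := by omega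
  -- the cylinder minimum and its coordinates
  obtain ⟨γ, hγI, hpos, h1, hleast, -, -, -, -⟩ := exists_cylinder_min (σ₁ := σ₁) hdeg hσ₂ hI0
  obtain ⟨u, v, w, hcγ'⟩ := (mem_iff_exists_coords hI γ).1 hγI
  set cγ : Fin 3 → ℤ := ![u, v, w] with hcγdef
  have hcγ : (den : K) * γ =
      lin θ b (cγ 0 * h11, cγ 0 * h12 + cγ 1 * h22, cγ 0 * h13 + cγ 1 * h23 + cγ 2 * h33) := by
    simpa [hcγdef] using hcγ'
  have hγeq : lin θ b (cγ 0 * h11, cγ 0 * h12 + cγ 1 * h22, cγ 0 * h13 + cγ 1 * h23 + cγ 2 * h33) / (den : K) = γ := by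
    rw [← hcγ, mul_div_cancel_left₀ _ (Nat.cast_ne_zero.2 hden0)]
  -- the true scale is scanned, and the row of `γ` is a candidate there
  obtain ⟨hXγ, h2X⟩ := zpow_log_le_and_lt hpos
  have hsS := natAbs_log_le σ₁ σ₂ hdeg hab hab1 hθ hσ₂ hden p11 p22 p33 hI hleast hpos h1 hcγ
  obtain ⟨haL, hbL, hdL, hhL, -, -⟩ := bounds_of_input a b den [h11, h12, h13, h22, h23, h33]
  set wγ : List ℤ := [cγ 0 * h11, cγ 0 * h12 + cγ 1 * h22, cγ 0 * h13 + cγ 1 * h23 + cγ 2 * h33] with hwγ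
  have hper : wγ ∈ perScale ((a, b), (den, [h11, h12, h13, h22, h23, h33]))
      (budget ((a, b), (den, [h11, h12, h13, h22, h23, h33]))) (Int.log 2 (σ₁ γ)) :=
    coords_mem_perScale σ₁ σ₂ hdeg hab hab1 hθ hσ₂ hden p11 p22 p33 hI hC1 hC2 hleast hpos h1 hcγ haL hbL hdL hhL
      hsS hXγ h2X
  have hall : wγ ∈ allCands ((a, b), (den, [h11, h12, h13, h22, h23, h33])) :=
    (mem_allCands_iff _ wγ).2 ⟨Int.log 2 (σ₁ γ), (neg_le_and_le_of_natAbs_le hsS).1,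
      (neg_le_and_le_of_natAbs_le hsS).2, hper⟩
  -- the exact filters
  have hcyl : inCyl ((a, b), (den, [h11, h12, h13, h22, h23, h33])) wγ = true := by
    rw [hwγ, inCyl_eq_true_iff]
    have hp := (sigma1_lin_div_pos_iff hdeg hab hab1 hθ σ₁ σ₂ hσ₂
      (cγ 0 * h11, cγ 0 * h12 + cγ 1 * h22, cγ 0 * h13 + cγ 1 * h23 + cγ 2 * h33) den hden0).1 (by rw [hγeq]; exact hpos)
    refine ⟨hp, ?_⟩
    exact (norm_sigma2_lin_div_lt_one_iff hdeg hab hab1 hθ σ₁ σ₂ hσ₂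
      (cγ 0 * h11, cγ 0 * h12 + cγ 1 * h22, cγ 0 * h13 + cγ 1 * h23 + cγ 2 * h33) den hden0
      (by rw [hγeq]; exact hpos)).1 (by rw [hγeq]; exact h1)
  have hval : wγ ∈ validCands ((a, b), (den, [h11, h12, h13, h22, h23, h33])) :=
    (mem_validCands_iff _ wγ).2 ⟨hall, hcyl⟩
  -- every valid candidate is a member of `I` in the cylinder
  have hvalid : ∀ w' ∈ validCands ((a, b), (den, [h11, h12, h13, h22, h23, h33])),
      ∃ x y z : ℤ, w' = [x, y, z] ∧ lin θ b (x, y, z) / (den : K) ∈ I ∧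
        0 < σ₁ (lin θ b (x, y, z) / (den : K)) ∧ ‖σ₂ (lin θ b (x, y, z) / (den : K))‖ < 1 := by
    intro w' hw'
    obtain ⟨hall', hcyl'⟩ := (mem_validCands_iff _ w').1 hw'
    obtain ⟨s', -, -, hper'⟩ := (mem_allCands_iff _ w').1 hall'
    have hm := mem_perScale_iff a b den h11 h12 h13 h22 h23 h33
      (budget ((a, b), (den, [h11, h12, h13, h22, h23, h33]))) s' w'
    dsimp only at hm
    obtain ⟨c0, c1, c2, -, -, -, hw'eq⟩ := hm.1 hper'
    obtain ⟨p, q, r, rfl⟩ : ∃ p q r : ℤ, w' = [p * h11, p * h12 + q * h22, p * h13 + q * h23 + r * h33] :=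
      ⟨_, _, _, hw'eq⟩
    refine ⟨_, _, _, rfl, ?_, ?_, ?_⟩
    · refine (mem_iff_exists_coords hI _).2 ⟨p, q, r, ?_⟩
      rw [mul_div_cancel₀ _ (Nat.cast_ne_zero.2 hden0)]
    · rw [inCyl_eq_true_iff] at hcyl'
      exact (sigma1_lin_div_pos_iff hdeg hab hab1 hθ σ₁ σ₂ hσ₂ _ den hden0).2 hcyl'.1
    · rw [inCyl_eq_true_iff] at hcyl'
      have hp := (sigma1_lin_div_pos_iff hdeg hab hab1 hθ σ₁ σ₂ hσ₂ _ den hden0).2 hcyl'.1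
      exact (norm_sigma2_lin_div_lt_one_iff hdeg hab hab1 hθ σ₁ σ₂ hσ₂ _ den hden0 hp).2 hcyl'.2
  -- the row of `γ` survives the selection
  have hmin : wγ ∈ minCands ((a, b), (den, [h11, h12, h13, h22, h23, h33])) := by
    rw [mem_minCands_iff]
    refine ⟨hval, fun w' hw' => ?_⟩
    obtain ⟨x, y, z, rfl, hxI, hxpos, hx1⟩ := hvalid w' hw'
    cases hlt : isLt ((a, b), (den, [h11, h12, h13, h22, h23, h33])) [x, y, z] wγ with
    | false => rfl
    | true =>
      exfalso
      rw [hwγ, isLt_eq_true_iff] at hlt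
      have hlt' := (sigma1_lin_div_lt_iff hdeg hab hab1 hθ σ₁ σ₂ hσ₂
        (cγ 0 * h11, cγ 0 * h12 + cγ 1 * h22, cγ 0 * h13 + cγ 1 * h23 + cγ 2 * h33) (x, y, z) den hden0).2 hlt
      rw [hγeq] at hlt'
      exact absurd (hleast _ hxI hxpos hx1) (not_le.2 hlt')
  -- the output
  have hne : minCands ((a, b), (den, [h11, h12, h13, h22, h23, h33])) ≠ [] := fun h => by
    rw [h] at hmin; exact List.not_mem_nil hmin
  obtain ⟨w₀, hw₀, hlex⟩ := exists_lexE_eq_of_ne_nil hne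
  obtain ⟨hw₀val, hw₀min⟩ := (mem_minCands_iff _ w₀).1 hw₀
  obtain ⟨x, y, z, rfl, hxI, hxpos, hx1⟩ := hvalid w₀ hw₀val
  have hlex' : lexE ((a, b), (den, [h11, h12, h13, h22, h23, h33])) = (x, y, z, den) := by
    rw [hlex]; rfl
  have hwle : σ₁ (lin θ b (x, y, z) / (den : K)) ≤ σ₁ γ := by
    have h := hw₀min wγ hval
    rw [hwγ] at h
    by_contra hcon
    push Not at hcon
    rw [← hγeq] at hcon
    have h2 := (sigma1_lin_div_lt_iff hdeg hab hab1 hθ σ₁ σ₂ hσ₂ (x, y, z)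
      (cγ 0 * h11, cγ 0 * h12 + cγ 1 * h22, cγ 0 * h13 + cγ 1 * h23 + cγ 2 * h33) den hden0).1 hcon
    have h3 := (isLt_eq_true_iff a b den [h11, h12, h13, h22, h23, h33] (cγ 0 * h11) (cγ 0 * h12 + cγ 1 * h22)
      (cγ 0 * h13 + cγ 1 * h23 + cγ 2 * h33) x y z).2 h2
    rw [h3] at h
    exact Bool.noConfusion h
  rw [hlex']
  refine ⟨hden, (hI _).2 hxI, hxpos, hx1, fun φ hφ hφpos hφ1 => hwle.trans (hleast φ ((hI φ).1 hφ) hφpos hφ1)⟩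

end Correctness

end PureCubicLexMin

end Literature.NumberTheory.CubicFields

end
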